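import Summits.CriticalPhenomena.SAWScalingLimit.Theorems.SAWLeftRightFKGFKGToTraversalBoundWitnessFinalTour
import Summits.CriticalPhenomena.SAWScalingLimit.Theorems.SAWLeftRightFKGFKGToTraversalBoundBoundaryBudget
import Summits.CriticalPhenomena.SAWScalingLimit.Theorems.SAWLeftRightFKGFKGToTraversalBoundWitnessSetup
import Summits.CriticalPhenomena.SAWScalingLimit.Theorems.SAWLeftRightFKGFKGToTraversalBoundWitnessRoute
import Summits.CriticalPhenomena.SAWScalingLimit.Theorems.SAWLeftRightFKGFKGToTraversalBoundWitnessChildSide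
import Summits.CriticalPhenomena.SAWScalingLimit.Theorems.SAWLeftRightFKGFKGToTraversalBoundOutlineArcWalk
import Summits.CriticalPhenomena.SAWScalingLimit.Theorems.SAWLeftRightFKGFKGToTraversalBoundWitnessAccounting
import HarnessLib

/-!
# Witness glue T7, part 2: FINAL ASSEMBLY `BoundaryBudget → NecklaceWitnessFarU`
(crux `SAWLeftRightFKG.FKGToTraversalBound`, stmt-CriticalPhenomena-1878; line `slit-necklace`,
registered stub `necklaceWitnessFarU_of_boundaryBudget` of the planar witness `stub_necklaceWitnessFarU`)

The planar witness closed modulo the boundary budget, by composing the landed glue theorems: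

* `final_witness_lt` (one far-tip configuration `cfg : FarTipCfg D`, the non-trivial case `τ < τ'`):
  `witness_setup` (the free component `F` of the first tip inside the carrier component `B`, with all their
  lattice facts) → `final_tour_data` (the boundary edge `e₀` at `t₀`, the minimal injective tour period `N`, the
  passage `0 < n₁ < N` at `t₁`) → `witness_childSide` (one of the two outline arcs `(0, n₁)`, `(n₁, N)` only touches
  LOWER-RANK far pieces) → `btour_arcWalk` (a lattice walk `p` inside `F` hugging that arc) → `witness_accounting`
  (`p` has no `Kc W nB` strictly separated windows across the shell: class changes + lower far pieces + boundary
  budget) → `witness_route` (loop-erase and transfer `p` to the domain graph: the far-tip witness).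
* `final_presented_at` (one presented configuration `cfg : PresCfg D`, one shell, one far-tip piece): the degenerate
  piece `τ = τ'` has the one-vertex witness (`final_hasFarTipWitness_self`); otherwise `final_witness_lt`.
* `necklaceWitnessFarU_of_boundaryBudget`: the boundary-budget FUNCTION of the shell is the budget of
  `BoundaryBudget` at the quarter radii `ρ₁ = σ₁ + (σ₂ - σ₁)/4`, `ρ₂ = σ₂ - (σ₂ - σ₁)/4` (junk `0` for a non-genuine
  shell); for a finite family of shells the budget statements, `16 δ < σ₂ - σ₁` and `0 < δ` hold eventually in the
  mesh simultaneously (`Filter.eventually_all`); the rank is `PresCfg.rk` (`final_rk_le_nfar`).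

Pure composition; no literature fact.
-/

noncomputable section

open Set SimpleGraph Filter Topology
open Literature.Probability.LatticeModels
open Literature.Probability.RandomPlanarGeometry
open Summit.CriticalPhenomena.SAWScalingLimit.Theorems.FKGToTraversalBound.Negative (dom)

namespace Summit.CriticalPhenomena.SAWScalingLimit.Theorems.FKGToTraversalBound.SlitNecklace

/-- **One far-tip configuration, non-trivial case** (`τ < τ'`): given a shell `D(y; σ₁, σ₂)` with
`16 δ < σ₂ - σ₁`, inner radii `σ₁ + 4δ ≤ ρ₁ < ρ₂ ≤ σ₂ - 4δ`, the band `2η`-far from both centres, the rank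
hypothesis on the lower far pieces (no `W + 1` windows across the `2δ`-thinner shell) and the boundary budget `nB`
at the radii `ρ₁, ρ₂`, the far-tip witness with `Kc W nB` windows exists: `witness_setup` → `final_tour_data` →
`witness_childSide` → `btour_arcWalk` → `witness_accounting` → `witness_route`. [folklore] -/
theorem final_witness_lt {D : DobrushinDomain} (cfg : FarTipCfg D) (y : ℂ) (σ₁ σ₂ ρ₁ ρ₂ : ℝ) (W nB : ℕ)
    (hσ₁ : 0 < σ₁) (hσ₁₂ : σ₁ < σ₂) (h16 : 16 * cfg.δ < σ₂ - σ₁) (hρ₁ : σ₁ + 4 * cfg.δ ≤ ρ₁)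
    (hρ₂ : ρ₂ ≤ σ₂ - 4 * cfg.δ) (hρ : ρ₁ < ρ₂)
    (hband : ∀ z : ℂ, σ₁ ≤ dist z y → dist z y ≤ σ₂ → 2 * cfg.η ≤ dist z cfg.ca ∧ 2 * cfg.η ≤ dist z cfg.cb)
    (hrank : ∀ i' j', IsFarPiece (meshPoint cfg.δ) cfg.γ (↑cfg.Sp) (↑cfg.S) i' j' cfg.ca cfg.cb cfg.η →
      cfg.rk i' < cfg.rk cfg.i →
      ¬ HasSepWindows (meshPoint cfg.δ) cfg.γ (W + 1) (i' + 1) (j' - 1) y (σ₁ + 2 * cfg.δ) (σ₂ - 2 * cfg.δ))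
    (hBB : ∀ (B' : Finset (Site 2)) (e : Site 2 × ODir) (N' q : ℕ) (a b : Fin q → ℕ),
      (∀ x ∈ B', meshPoint cfg.δ x ∈ D.carrier) →
      (∀ x ∈ B', ∀ x' ∈ B', (zdGraph 2).Adj x x' → (discreteDomainGraph D.carrier cfg.δ).Adj x x') →
      (∀ x ∈ B', ∀ x' ∈ B', ∃ w : (zdGraph 2).Walk x x', ∀ z ∈ w.support, z ∈ B') →
      (∀ x x' : Site 2, x ∉ B' → x' ∉ B' → ∃ w : (zdGraph 2).Walk x x', ∀ z ∈ w.support, z ∉ B') →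
      IsBEdge (↑B' : Set (Site 2)) e → 0 < N' → btour (↑B' : Set (Site 2)) e N' = e →
      (∀ j j', j < N' → j' < N' → btour (↑B' : Set (Site 2)) e j = btour (↑B' : Set (Site 2)) e j' → j = j') →
      (∀ mm, a mm < b mm ∧ b mm < N') → (∀ ⦃mm mm' : Fin q⦄, mm < mm' → b mm < a mm') →
      (∀ mm, (dist (meshPoint cfg.δ (bsite (btour (↑B' : Set (Site 2)) e (a mm)))) y ≤ ρ₁ ∧
          ρ₂ ≤ dist (meshPoint cfg.δ (bsite (btour (↑B' : Set (Site 2)) e (b mm)))) y) ∨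
        (ρ₂ ≤ dist (meshPoint cfg.δ (bsite (btour (↑B' : Set (Site 2)) e (a mm)))) y ∧
          dist (meshPoint cfg.δ (bsite (btour (↑B' : Set (Site 2)) e (b mm)))) y ≤ ρ₁)) →
      (∀ mm, FacesBoundary D.carrier cfg.δ (btour (↑B' : Set (Site 2)) e (a mm)) ∧
        FacesBoundary D.carrier cfg.δ (btour (↑B' : Set (Site 2)) e (b mm))) →
      q ≤ nB) :
    HasFarTipWitness D.carrier cfg.δ (↑cfg.Sp) cfg.γ cfg.τ cfg.τ' (cfg.Kc W nB) y σ₁ σ₂ := by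
  obtain ⟨F, B, hF, hB, ht₀F, ht₁F, hFB, hBΛ, hBD, hmid, hFK, hFconn, hFcompl, hFcont, hFG, hBconn, hBcompl,
    hBcont, hBG, hKatt, hprev, hnext, hadj₀, hadj₁, hne⟩ := witness_setup cfg
  obtain ⟨e₀, n₁, N, he₀, he₀s, he₀c, hn₁pos, hn₁N, hper, hinj, hn₁s, hn₁c⟩ :=
    final_tour_data cfg F ht₀F ht₁F hFconn hFcompl hprev hnext hadj₀ hadj₁ hne
  obtain ⟨m, n, hmn, hchild⟩ := witness_childSide cfg F B e₀ n₁ N hF hB hBΛ hmid hFK hFconn hFcont hFG hBG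
    hKatt he₀ he₀s he₀c hn₁pos hn₁N hper hinj hn₁s hn₁c
  have hmn' : m ≤ n := by rcases hmn with ⟨h1, h2⟩ | ⟨h1, h2⟩ <;> omega
  obtain ⟨p, φ, hpF, hφ, hφb⟩ := btour_arcWalk (↑F : Set (Site 2)) e₀ m n he₀ hmn'
  have hpF' : ∀ z ∈ p.support, z ∈ F := fun z hz => Finset.mem_coe.1 (hpF z hz)
  have hacc := witness_accounting cfg F B e₀ n₁ N m n p φ y σ₁ σ₂ ρ₁ ρ₂ W nB hF hB hFB hBΛ hBD hmid hFK hFconn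
    hFcont hFG hBconn hBcompl hBcont hBG hKatt he₀ he₀s he₀c hn₁pos hn₁N hper hinj hn₁s hn₁c hmn hpF' hφ hφb
    hσ₁ hσ₁₂ h16 hρ₁ hρ₂ hρ hband hrank hchild hBB
  exact witness_route cfg F e₀ n₁ N m n _ y σ₁ σ₂ p hFK hFG he₀s hn₁s hper hmn hpF' hacc

/-- **One presented configuration, one shell, one far-tip piece.**  With the boundary budget `nB` at the quarter
radii `σ₁ + (σ₂ - σ₁)/4`, `σ₂ - (σ₂ - σ₁)/4` of a genuine shell with `16 δ < σ₂ - σ₁` whose band is `2η`-far from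
the centres, and the rank hypothesis on the lower far pieces, every far-tip piece has the witness with `Kc W nB`
windows: the degenerate piece `τ = τ'` by `final_hasFarTipWitness_self`, the other by `final_witness_lt`.
[folklore] -/
theorem final_presented_at {D : DobrushinDomain} (cfg : PresCfg D) (y : ℂ) (σ₁ σ₂ : ℝ) (nB W i j τ τ' : ℕ)
    (hσ₁ : 0 < σ₁) (hσ₁₂ : σ₁ < σ₂) (h16 : 16 * cfg.δ < σ₂ - σ₁)
    (hband : ∀ z : ℂ, σ₁ ≤ dist z y → dist z y ≤ σ₂ → 2 * cfg.η ≤ dist z cfg.ca ∧ 2 * cfg.η ≤ dist z cfg.cb)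
    (hft : IsFarTipPiece (meshPoint cfg.δ) cfg.γ (↑cfg.Sp) i j τ τ' cfg.ca cfg.cb cfg.η)
    (hrank : ∀ i' j', IsFarPiece (meshPoint cfg.δ) cfg.γ (↑cfg.Sp) (↑cfg.S) i' j' cfg.ca cfg.cb cfg.η →
      cfg.rk i' < cfg.rk i →
      ¬ HasSepWindows (meshPoint cfg.δ) cfg.γ (W + 1) (i' + 1) (j' - 1) y (σ₁ + 2 * cfg.δ) (σ₂ - 2 * cfg.δ))
    (hBB : ∀ (B' : Finset (Site 2)) (e : Site 2 × ODir) (N' q : ℕ) (a b : Fin q → ℕ),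
      (∀ x ∈ B', meshPoint cfg.δ x ∈ D.carrier) →
      (∀ x ∈ B', ∀ x' ∈ B', (zdGraph 2).Adj x x' → (discreteDomainGraph D.carrier cfg.δ).Adj x x') →
      (∀ x ∈ B', ∀ x' ∈ B', ∃ w : (zdGraph 2).Walk x x', ∀ z ∈ w.support, z ∈ B') →
      (∀ x x' : Site 2, x ∉ B' → x' ∉ B' → ∃ w : (zdGraph 2).Walk x x', ∀ z ∈ w.support, z ∉ B') →
      IsBEdge (↑B' : Set (Site 2)) e → 0 < N' → btour (↑B' : Set (Site 2)) e N' = e →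
      (∀ j j', j < N' → j' < N' → btour (↑B' : Set (Site 2)) e j = btour (↑B' : Set (Site 2)) e j' → j = j') →
      (∀ mm, a mm < b mm ∧ b mm < N') → (∀ ⦃mm mm' : Fin q⦄, mm < mm' → b mm < a mm') →
      (∀ mm, (dist (meshPoint cfg.δ (bsite (btour (↑B' : Set (Site 2)) e (a mm)))) y ≤ σ₁ + (σ₂ - σ₁) / 4 ∧
          σ₂ - (σ₂ - σ₁) / 4 ≤ dist (meshPoint cfg.δ (bsite (btour (↑B' : Set (Site 2)) e (b mm)))) y) ∨
        (σ₂ - (σ₂ - σ₁) / 4 ≤ dist (meshPoint cfg.δ (bsite (btour (↑B' : Set (Site 2)) e (a mm)))) y ∧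
          dist (meshPoint cfg.δ (bsite (btour (↑B' : Set (Site 2)) e (b mm)))) y ≤ σ₁ + (σ₂ - σ₁) / 4)) →
      (∀ mm, FacesBoundary D.carrier cfg.δ (btour (↑B' : Set (Site 2)) e (a mm)) ∧
        FacesBoundary D.carrier cfg.δ (btour (↑B' : Set (Site 2)) e (b mm))) →
      q ≤ nB) :
    HasFarTipWitness D.carrier cfg.δ (↑cfg.Sp) cfg.γ τ τ' (cfg.Kc W nB) y σ₁ σ₂ := by
  rcases hft.2.2.1.eq_or_lt with heq | hlt
  · subst heq
    refine final_hasFarTipWitness_self cfg.hγ ?_ (hft.2.2.2.1.le.trans hft.1.2.1.1)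
      (hft.1.2.2.2 τ hft.2.1 hft.2.2.2.1) hσ₁₂
    unfold PresCfg.Kc
    positivity
  · have hρ₁ : σ₁ + 4 * cfg.δ ≤ σ₁ + (σ₂ - σ₁) / 4 := by linarith
    have hρ₂ : σ₂ - (σ₂ - σ₁) / 4 ≤ σ₂ - 4 * cfg.δ := by linarith
    have hρ : σ₁ + (σ₂ - σ₁) / 4 < σ₂ - (σ₂ - σ₁) / 4 := by linarith
    exact final_witness_lt ⟨cfg, i, j, τ, τ', hft, hlt⟩ y σ₁ σ₂ (σ₁ + (σ₂ - σ₁) / 4) (σ₂ - (σ₂ - σ₁) / 4) W nB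
      hσ₁ hσ₁₂ h16 hρ₁ hρ₂ hρ hband hrank hBB

/-- **FINAL ASSEMBLY (registered stub): the boundary budget gives the rank-uniform far-tip necklace witness.**
The budget function of the shell is the constant of `BoundaryBudget` at the quarter radii (junk `0` for a
non-genuine shell); for a finite family of genuine shells the budget statements, `16 δ < σ₂ - σ₁` and `0 < δ` hold
simultaneously for all small meshes (`Filter.eventually_all`); then, for a presented chord, the rank is
`PresCfg.rk` (height `≤ #far`, `final_rk_le_nfar`) and every shell / far-tip piece is served by
`final_presented_at`. [folklore] -/
theorem necklaceWitnessFarU_of_boundaryBudget : BoundaryBudget → NecklaceWitnessFarU := by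
  intro hBB D
  classical
  have hρ : ∀ σ₁ σ₂ : ℝ, 0 < σ₁ ∧ σ₁ < σ₂ →
      0 < σ₁ + (σ₂ - σ₁) / 4 ∧ σ₁ + (σ₂ - σ₁) / 4 < σ₂ - (σ₂ - σ₁) / 4 := fun σ₁ σ₂ h =>
    ⟨by linarith [h.1, h.2], by linarith [h.2]⟩
  refine ⟨fun y σ₁ σ₂ => if h : 0 < σ₁ ∧ σ₁ < σ₂ then Classical.choose (hBB D y (σ₁ + (σ₂ - σ₁) / 4)
    (σ₂ - (σ₂ - σ₁) / 4) (hρ σ₁ σ₂ h).1 (hρ σ₁ σ₂ h).2) else 0, ?_⟩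
  intro ι _ y σ₁ σ₂ hσ
  have hBBev := fun t : ι => Classical.choose_spec (hBB D (y t) (σ₁ t + (σ₂ t - σ₁ t) / 4)
    (σ₂ t - (σ₂ t - σ₁ t) / 4) (hρ (σ₁ t) (σ₂ t) (hσ t)).1 (hρ (σ₁ t) (σ₂ t) (hσ t)).2)
  have h16ev : ∀ t, ∀ᶠ δ in 𝓝[>] (0 : ℝ), 16 * δ < σ₂ t - σ₁ t := fun t => by
    have h : (0 : ℝ) < (σ₂ t - σ₁ t) / 16 := by linarith [(hσ t).2]
    exact ((eventually_lt_nhds h).filter_mono nhdsWithin_le_nhds).mono fun δ hδ => by linarith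
  have hpos : ∀ᶠ δ in 𝓝[>] (0 : ℝ), δ ∈ Ioi 0 := eventually_mem_nhdsWithin
  filter_upwards [Filter.eventually_all.2 hBBev, Filter.eventually_all.2 h16ev, hpos] with δ hBBδ h16 hδ
  intro c C S Ka Kb a₀ b₀ ca cb ιa ιb η γ hid hatt hγ ha₀ hb₀ hKa hKb hιa hιb hab
  refine ⟨(⟨δ, Set.mem_Ioi.1 hδ, c, C, S, Ka, Kb, a₀, b₀, ca, cb, ιa, ιb, η, γ, hid, hatt, hγ, ha₀, hb₀, hKa, hKb,
    hιa, hιb, hab⟩ : PresCfg D).rk, final_rk_le_nfar _, ?_⟩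
  intro t _ hband i j τ τ' W hft hrank
  rw [dif_pos (hσ t)]
  exact final_presented_at ⟨δ, Set.mem_Ioi.1 hδ, c, C, S, Ka, Kb, a₀, b₀, ca, cb, ιa, ιb, η, γ, hid, hatt, hγ, ha₀,
    hb₀, hKa, hKb, hιa, hιb, hab⟩ (y t) (σ₁ t) (σ₂ t) _ W i j τ τ' (hσ t).1 (hσ t).2 (h16 t) hband hft hrank (hBBδ t)

end Summit.CriticalPhenomena.SAWScalingLimit.Theorems.FKGToTraversalBound.SlitNecklace

end
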